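/-
Origin: expansion seat `planner-pub-hodgecm-pohl-g13-0`, handover #3 2026-08-18T13:31:19Z (md5 f44faa5b7d6e735c7cb69944007954d1, 247 l. — supersedes the CLAIM bytes 44d16eab (+ quadratic corollaries); RUN 30 additive leaf; lands AFTER my #2 HodgeCM/Proofs/Pohlmann/GaloisSpanAntiSpace.lean (b7394864); rewrite import Pohl13.GaloisSpanAntiSpace -> HodgeCM.Proofs.Pohlmann.GaloisSpanAntiSpace x1) (`HOME/pub-hodgecm-pohl-g13/lean/Pohl13/GaloisSpanRank.lean`, md5 f44faa5b, 247 lines);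
landed by the gen-8 packager in gate run 30 as `HodgeCM/Proofs/Pohlmann/GaloisSpanRank.lean` (import ^import Pohl13\.GaloisSpanAntiSpace[ \t]*$→import HodgeCM.Proofs.Pohlmann.GaloisSpanAntiSpace ×1).
-/
/-
Copyright: pub-hodgecm formalisation cell (harness21, 2026). New file (not vendored).
Origin: HOME/pub-hodgecm-pohl-g13/lean/Pohl13/GaloisSpanRank.lean — session planner-pub-hodgecm-pohl-g13-0 (unit pub-hodgecm-pohl-g13),
EXPANSION part (b) `PohlmannSpan`, generation 13, file 3.  Intended final place: `HodgeCM/Proofs/Pohlmann/GaloisSpanRank.lean`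
(module `HodgeCM.Proofs.Pohlmann.GaloisSpanRank`).  ADDITIVE leaf.  WIP import `Pohl13.GaloisSpanAntiSpace` = this seat's file 2
`HodgeCM/Proofs/Pohlmann/GaloisSpanAntiSpace.lean` (rewrite to `import HodgeCM.Proofs.Pohlmann.GaloisSpanAntiSpace` on landing).
-/
import Summits.HodgeConjecture.HodgeCM.Proofs.Pohlmann.GaloisSpanAntiSpace

/-!
# The Galois span condition as a RANK condition: `rank_ℚ {a_σ} = g²`

File 2 (`GaloisSpanAntiSpace.lean`) showed: for a CM field with `Aut(F/ℚ) = {1, c}`, LIN(F) (`NonGalois.GalSpanCondition F n`) holds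
iff the antisymmetrised graphs `a_σ`, `σ ∈ Gal(E^c/ℚ)`, span the anti-space `NonGalois.antiSpace F`.  Here the anti-space gets its
dimension, turning LIN into a NUMERIC condition on the permutation image of the Galois group:

* `NonGalois.two_mul_ncard_type` — a CM type has `g = [F:ℚ]/2` elements (`2 · #Θ = [F:ℚ]`).
* `NonGalois.antiSpaceEquiv Θ : antiSpace F ≃ₗ[ℚ] (Θ × Θ → ℚ)` — restriction to `Θ × Θ` for any CM type `Θ` (an anti-function is
  determined by its values on `Θ × Θ`, and every function there extends: `Σ h(q) e_q`); hence
  `NonGalois.finrank_antiSpace : finrank_ℚ (antiSpace F) = (#Θ)²` `= ([F:ℚ]/2)²` (`finrank_antiSpace_eq`).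
* `NonGalois.finrank_galAntiSpan_le` — for every CM field `rank_ℚ {a_σ} ≤ g²`;
  **THEOREM** `NonGalois.galSpanCondition_iff_finrank_eq` (`F` CM, `AutPair F`):
  `GalSpanCondition F n ↔ finrank_ℚ (galAntiSpan F n) = ([F:ℚ]/2)²` — LIN(F) iff the `a_σ` have FULL RANK `g²`.
* `Universe.forall_naivePohlmannSpanAt_iff_finrank_eq` — under the model axioms and N1–N3, for a CM field with `Aut(F/ℚ) = {1, c}`:
  the naive Pohlmann span holds for all families of CM types iff `finrank_ℚ (galAntiSpan F 0) = F.halfDegree ^ 2`.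
* `NonGalois.galSpanCondition_of_finrank_eq_two` — imaginary quadratic fields satisfy LIN (the anti-space is the line `ℚ a_1`);
  `Universe.naivePohlmannSpanAt_of_finrank_eq_two` — the naive Pohlmann span for every family of CM types of an imaginary
  quadratic field (products of CM elliptic curves), from the model axioms and N1–N3.

So the only datum of `F` that matters is the rank of the `ℚ`-span of the `g²`-vectors `a_σ(s, x) = [σs = x] − [σs = x̄]`
(`(s, x) ∈ Θ × Θ`) over the permutation image of `Gal(F̃/ℚ)` — a finite computation once that image is known.
Nothing is posited; nothing is cited.
-/

noncomputable section

open scoped TensorProduct NumberField BigOperators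
open NumberField NumberField.ComplexEmbedding

attribute [local instance] Classical.propDecidable

namespace HodgeCM

open Literature.AlgebraicGeometry.Motives (CMType HodgeStructure)
open HodgeCM.Pohlmann HodgeCM.GaoUllmo HodgeCM.CMTypeOps

namespace NonGalois

/-! ### Elementary anti-functions on a CM type -/

section OnType

variable {F : Type} [Field F]

/-- (Ported verbatim from the HodgeCMPerL package; no docstring in the source.) -/
theorem conjugate_ne_of_mem_of_mem (Θ : CMType F) {s s' : F →+* ℂ} (hs : s ∈ Θ.1) (hs' : s' ∈ Θ.1) : conjugate s ≠ s' :=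
  fun h => (mem_iff_conjugate_notMem Θ s).mp hs (by rw [h]; exact hs')

/-- On a CM type, `c_y(x) = [y = x]`. -/
theorem sgnAt_of_mem_of_mem (Θ : CMType F) {y x : F →+* ℂ} (hy : y ∈ Θ.1) (hx : x ∈ Θ.1) :
    sgnAt y x = if y = x then 1 else 0 := by
  rw [sgnAt, if_neg (conjugate_ne_of_mem_of_mem Θ hy hx), sub_zero]

/-- On `Θ × Θ` the elementary anti-functions restrict to the standard basis. -/
theorem elemAnti_apply_of_mem (Θ : CMType F) {s₀ x₀ s x : F →+* ℂ} (hs₀ : s₀ ∈ Θ.1) (hx₀ : x₀ ∈ Θ.1) (hs : s ∈ Θ.1)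
    (hx : x ∈ Θ.1) : elemAnti s₀ x₀ (s, x) = if s₀ = s ∧ x₀ = x then 1 else 0 := by
  rw [elemAnti_apply, sgnAt_of_mem_of_mem Θ hs₀ hs, sgnAt_of_mem_of_mem Θ hx₀ hx]
  by_cases h1 : s₀ = s <;> by_cases h2 : x₀ = x <;> simp [h1, h2]

/-- An anti-function is determined by its values on `Θ × Θ`. -/
theorem eq_zero_of_forall_mem {Θ : CMType F} {f : (F →+* ℂ) × (F →+* ℂ) → ℚ} (hf : f ∈ antiSpace F)
    (h0 : ∀ s ∈ Θ.1, ∀ x ∈ Θ.1, f (s, x) = 0) : f = 0 := by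
  have hx : ∀ s' x, (∀ x' ∈ Θ.1, f (s', x') = 0) → f (s', x) = 0 := by
    intro s' x hs'
    by_cases hxΘ : x ∈ Θ.1
    · exact hs' x hxΘ
    · have hcx : conjugate x ∈ Θ.1 := (conjugate_mem_iff_notMem Θ x).mpr hxΘ
      have h1 := (hf s' (conjugate x)).1
      rw [(involutive_conjugate F) x] at h1
      rw [h1, hs' _ hcx, neg_zero]
  funext q
  obtain ⟨s, x⟩ := q
  rw [Pi.zero_apply]
  by_cases hs : s ∈ Θ.1
  · exact hx s x (h0 s hs)
  · have hcs : conjugate s ∈ Θ.1 := (conjugate_mem_iff_notMem Θ s).mpr hs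
    have h1 := (hf (conjugate s) x).2
    rw [(involutive_conjugate F) s] at h1
    rw [h1, hx (conjugate s) x (h0 _ hcs), neg_zero]

/-- Restriction of functions on `Hom × Hom` to `Θ × Θ`. -/
def resType (Θ : CMType F) : ((F →+* ℂ) × (F →+* ℂ) → ℚ) →ₗ[ℚ] (↥Θ.1 × ↥Θ.1 → ℚ) where
  toFun f q := f ((q.1 : F →+* ℂ), (q.2 : F →+* ℂ))
  map_add' _ _ := rfl
  map_smul' _ _ := rfl

/-- (Ported verbatim from the HodgeCMPerL package; no docstring in the source.) -/
theorem resType_apply (Θ : CMType F) (f : (F →+* ℂ) × (F →+* ℂ) → ℚ) (q : ↥Θ.1 × ↥Θ.1) :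
    resType Θ f q = f ((q.1 : F →+* ℂ), (q.2 : F →+* ℂ)) := rfl

variable [NumberField F]

/-- `2 · #Θ = [F:ℚ]` for a CM type `Θ` (`Θ ⊔ Θ̄ = Hom(F, ℂ)`). -/
theorem two_mul_ncard_type (Θ : CMType F) : 2 * Θ.1.ncard = Module.finrank ℚ F := by
  have h1 : conjugate '' Θ.1 = Θ.1ᶜ := by
    ext x
    simp only [Set.mem_image, Set.mem_compl_iff]
    constructor
    · rintro ⟨y, hy, rfl⟩
      exact (mem_iff_conjugate_notMem Θ y).mp hy
    · intro hx
      exact ⟨conjugate x, (conjugate_mem_iff_notMem Θ x).mpr hx, involutive_conjugate F x⟩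
  have h2 : (conjugate '' Θ.1).ncard = Θ.1.ncard := Set.ncard_image_of_injective _ (involutive_conjugate F).injective
  have h3 := Set.ncard_add_ncard_compl Θ.1
  rw [← h1, h2, Nat.card_eq_fintype_card, NumberField.Embeddings.card] at h3
  omega

/-- (Ported verbatim from the HodgeCMPerL package; no docstring in the source.) -/
theorem ncard_type_eq (Θ : CMType F) : Θ.1.ncard = Module.finrank ℚ F / 2 := by
  have h := two_mul_ncard_type Θ
  omega

/-! ### The anti-space is `(Θ × Θ → ℚ)` -/

/-- The odd extension of `h : Θ × Θ → ℚ`: `Σ_q h(q) e_q`. -/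
def extType (Θ : CMType F) (h : ↥Θ.1 × ↥Θ.1 → ℚ) : (F →+* ℂ) × (F →+* ℂ) → ℚ :=
  ∑ q : ↥Θ.1 × ↥Θ.1, h q • elemAnti (q.1 : F →+* ℂ) (q.2 : F →+* ℂ)

/-- (Ported verbatim from the HodgeCMPerL package; no docstring in the source.) -/
theorem extType_mem_antiSpace (Θ : CMType F) (h : ↥Θ.1 × ↥Θ.1 → ℚ) : extType Θ h ∈ antiSpace F :=
  Submodule.sum_mem _ fun _ _ => Submodule.smul_mem _ _ (elemAnti_mem_antiSpace _ _)

/-- (Ported verbatim from the HodgeCMPerL package; no docstring in the source.) -/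
theorem resType_extType (Θ : CMType F) (h : ↥Θ.1 × ↥Θ.1 → ℚ) : resType Θ (extType Θ h) = h := by
  funext q'
  rw [resType_apply, extType, Finset.sum_apply]
  simp only [Pi.smul_apply, smul_eq_mul]
  have hq : ∀ q : ↥Θ.1 × ↥Θ.1, h q * elemAnti (q.1 : F →+* ℂ) (q.2 : F →+* ℂ) ((q'.1 : F →+* ℂ), (q'.2 : F →+* ℂ))
      = if q = q' then h q else 0 := by
    intro q
    rw [elemAnti_apply_of_mem Θ q.1.2 q.2.2 q'.1.2 q'.2.2]
    have he : ((q.1 : F →+* ℂ) = q'.1 ∧ (q.2 : F →+* ℂ) = q'.2) ↔ q = q' := by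
      rw [Prod.ext_iff, Subtype.ext_iff, Subtype.ext_iff]
    simp only [he, mul_ite, mul_one, mul_zero]
  simp only [hq]
  rw [Finset.sum_ite_eq' Finset.univ q']
  simp only [Finset.mem_univ, if_true]

/-- **The anti-space is `(Θ × Θ → ℚ)`**, for any CM type `Θ`, via restriction. -/
def antiSpaceEquiv (Θ : CMType F) : antiSpace F ≃ₗ[ℚ] (↥Θ.1 × ↥Θ.1 → ℚ) :=
  LinearEquiv.ofBijective ((resType Θ).domRestrict (antiSpace F))
    ⟨(injective_iff_map_eq_zero _).mpr fun f hf0 =>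
        Subtype.ext (eq_zero_of_forall_mem (Θ := Θ) f.2 fun s hs x hx => congr_fun hf0 (⟨s, hs⟩, ⟨x, hx⟩)),
      fun h => ⟨⟨extType Θ h, extType_mem_antiSpace Θ h⟩, resType_extType Θ h⟩⟩

/-- (Ported verbatim from the HodgeCMPerL package; no docstring in the source.) -/
theorem antiSpaceEquiv_apply (Θ : CMType F) (f : antiSpace F) (q : ↥Θ.1 × ↥Θ.1) :
    antiSpaceEquiv Θ f q = (f : (F →+* ℂ) × (F →+* ℂ) → ℚ) ((q.1 : F →+* ℂ), (q.2 : F →+* ℂ)) := rfl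

/-- `dim_ℚ (anti-space) = (#Θ)²`. -/
theorem finrank_antiSpace (Θ : CMType F) : Module.finrank ℚ (antiSpace F) = Θ.1.ncard ^ 2 := by
  rw [(antiSpaceEquiv Θ).finrank_eq, Module.finrank_fintype_fun_eq_card, Fintype.card_prod, ← Nat.card_eq_fintype_card,
    Nat.card_coe_set_eq, sq]

/-- `dim_ℚ (anti-space) = ([F:ℚ]/2)²` (`F` totally complex, so that a CM type exists). -/
theorem finrank_antiSpace_eq [IsTotallyComplex F] : Module.finrank ℚ (antiSpace F) = (Module.finrank ℚ F / 2) ^ 2 := by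
  rw [finrank_antiSpace (placesType F), ncard_type_eq]

end OnType

/-! ### LIN(F) as a rank condition -/

section Rank

variable {F : Type} [Field F] [NumberField F] [IsCMField F] {n : ℕ}

/-- For every CM field: `rank_ℚ {a_σ} ≤ g²`. -/
theorem finrank_galAntiSpan_le : Module.finrank ℚ (galAntiSpan F n) ≤ (Module.finrank ℚ F / 2) ^ 2 := by
  rw [← finrank_antiSpace_eq]
  exact Submodule.finrank_mono galAntiSpan_le_antiSpace

/-- **THEOREM.**  For a CM field with `Aut(F/ℚ) = {1, c}`: LIN(F) iff the `a_σ`, `σ ∈ Gal(E^c/ℚ)`, have full rank `g²`. -/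
theorem galSpanCondition_iff_finrank_eq (hA : AutPair F) :
    GalSpanCondition F n ↔ Module.finrank ℚ (galAntiSpan F n) = (Module.finrank ℚ F / 2) ^ 2 := by
  rw [galSpanCondition_iff_galAntiSpan_eq hA, ← finrank_antiSpace_eq]
  exact ⟨fun h => by rw [h], fun h => Submodule.eq_of_le_of_finrank_eq galAntiSpan_le_antiSpace h⟩

/-- … and LIN(F) fails iff the rank is `< g²`. -/
theorem not_galSpanCondition_iff_finrank_lt (hA : AutPair F) :
    ¬ GalSpanCondition F n ↔ Module.finrank ℚ (galAntiSpan F n) < (Module.finrank ℚ F / 2) ^ 2 := by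
  rw [galSpanCondition_iff_finrank_eq hA]
  have h := finrank_galAntiSpan_le (F := F) (n := n)
  omega

/-- **Quadratic fields.**  For an imaginary quadratic field the anti-space is a line, spanned by `a_1 ≠ 0`: LIN holds (no Galois
theory needed). -/
theorem galSpanCondition_of_finrank_eq_two (h2 : Module.finrank ℚ F = 2) (n : ℕ) : GalSpanCondition F n := by
  apply galSpanCondition_of_antiSpace_le
  have h1 : antiInd (galF n (1 : galoisClosure (Fin (n + 1) → F) ≃ₐ[ℚ] galoisClosure (Fin (n + 1) → F))) ≠ 0 := by
    obtain ⟨s⟩ : Nonempty (F →+* ℂ) := by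
      have hc : 0 < Fintype.card (F →+* ℂ) := by rw [Embeddings.card]; exact Module.finrank_pos
      exact Fintype.card_pos_iff.mp hc
    intro h0
    have := congr_fun h0 (s, s)
    rw [antiInd_eq_sgnAt, galF_one, Pi.zero_apply] at this
    exact one_ne_zero ((sgnAt_self s).symm.trans this)
  have hpos : 0 < Module.finrank ℚ (galAntiSpan F n) := by
    rw [Module.finrank_pos_iff_exists_ne_zero]
    exact ⟨⟨_, antiInd_galF_mem_galAntiSpan 1⟩, fun h => h1 (congr_arg Subtype.val h)⟩
  have hle : Module.finrank ℚ (antiSpace F) ≤ Module.finrank ℚ (galAntiSpan F n) := by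
    rw [finrank_antiSpace_eq, h2]; exact hpos
  exact (Submodule.eq_of_le_of_finrank_le galAntiSpan_le_antiSpace hle).ge

/-- Hence agreeing index sets for every family of CM types of an imaginary quadratic field (CM elliptic curves). -/
theorem indexSetsAgree_of_finrank_eq_two (h2 : Module.finrank ℚ F = 2) {m : ℕ} (Θ : Fin (m + 1) → CMType F) (p : ℕ) :
    IndexSetsAgree Θ p :=
  indexSetsAgree_of_galSpanCondition (galSpanCondition_of_finrank_eq_two h2 m) Θ p

end Rank

end NonGalois

/-! ### Universe level -/

namespace Universe

open NonGalois SexticCM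

variable {U : Universe}

/-- Under the model axioms and N1–N3, for a CM field with `Aut(F/ℚ) = {1, c}`: the naive Pohlmann span holds at every `(n, Θ, p)` iff
the antisymmetrised graphs `a_σ` of `Gal(F^c/ℚ)` on `Hom(F, ℂ)` have full rank `g²` (`g = F.halfDegree`). -/
theorem forall_naivePohlmannSpanAt_iff_finrank_eq (M : U.ModelAxioms) (hN1 : U.Fact_cupExterior) (hN2 : U.Fact_cup_hodge)
    (hN3 : U.Fact_pull_H0) (F : CMField) (hA : AutPair F) :
    (∀ (n : ℕ) (Θ : Fin (n + 1) → CMType F) (p : ℕ), U.NaivePohlmannSpanAt F Θ p) ↔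
      Module.finrank ℚ (galAntiSpan F 0) = F.halfDegree ^ 2 := by
  rw [forall_naivePohlmannSpanAt_iff_galSpanCondition M hN1 hN2 hN3 F, galSpanCondition_iff_finrank_eq hA]
  rfl

/-- The sextic `K₂` of pohl-g11: the `a_σ` have rank `< 9`. -/
theorem finrank_galAntiSpan_K₂_lt (n : ℕ) : Module.finrank ℚ (galAntiSpan K₂CM n) < (Module.finrank ℚ K₂CM / 2) ^ 2 :=
  (not_galSpanCondition_iff_finrank_lt autPair_K₂).mp (not_galSpanCondition_K₂ n)

/-- Imaginary quadratic fields: the naive Pohlmann span for every family of CM types (products of CM elliptic curves with CM by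
`F`), from the model axioms and N1–N3. -/
theorem naivePohlmannSpanAt_of_finrank_eq_two (M : U.ModelAxioms) (hN1 : U.Fact_cupExterior) (hN2 : U.Fact_cup_hodge)
    (hN3 : U.Fact_pull_H0) (F : CMField) (h2 : Module.finrank ℚ F = 2) {n : ℕ} (Θ : Fin (n + 1) → CMType F) (p : ℕ) :
    U.NaivePohlmannSpanAt F Θ p :=
  naivePohlmannSpanAt_of_galSpanCondition M hN1 hN2 hN3 (galSpanCondition_of_finrank_eq_two h2 n) Θ p

end Universe

end HodgeCM
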